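import Mathlib.Analysis.InnerProductSpace.Trace
import Mathlib.LinearAlgebra.Eigenspace.Minpoly
import Mathlib.Algebra.Order.Archimedean.Basic
import HarnessLib

/-!
# The trace of a bounded polynomial in a positive operator; a polynomial `P` with `P(0) = 0`, `P(1) = 1`, `0 ≤ P ≤ 2` on `[0, R]`
(Jacquet–Langlands, *Automorphic Forms on GL(2)*, LNM 114 (1970), Lemma 16.1.1 — the analytic step; Reed–Simon, *Methods of Modern
Mathematical Physics I* (1980), Thm. VII.1 (e) (functional calculus: `‖P(A)‖ = sup_{λ ∈ σ(A)} |P(λ)|`))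

Topic `Analysis/InnerProduct`; namespace `Literature.Analysis.InnerProduct`.  THEOREMS ONLY (no definition, no instance, no notation, no
named fact, no `sorry`); Mathlib only.  Generic linear algebra, road-independent: the two elementary analytic facts behind the
«positivity trick» that upgrades linear independence of characters from FINITE to COUNTABLE families of UNITARY representations
([JacquetLanglands1970, Lemma 16.1.1]; [Rogawski1990, Prop. 13.8.1]): a self-adjoint operator `T` with `0 ≤ ⟪T x, x⟫ ≤ R‖x‖²` and a real
polynomial `P` with `0 ≤ P ≤ C` on `[0, R]` give `0 ≤ tr P(T) ≤ C · dim` (spectral theorem, Mathlib ★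
`LinearMap.IsSymmetric.eigenvectorBasis`, ★ `LinearMap.trace_eq_sum_inner`, ★ `Module.End.aeval_apply_of_hasEigenvector`), and for every
`R ≥ 1` there IS such a polynomial with `P(0) = 0`, `P(1) = 1`, `C = 2` (namely `P(t) = (1 − (1 − t/R)ⁿ)/(1 − (1 − 1/R)ⁿ)` with
`(1 − 1/R)ⁿ ≤ 1/2`).  Cell `hodgecm-mathlib` (D-0151), floor 0, programme P3 rung 4: analytic half of the in-house discharge of the letter ★
`Literature.NumberTheory.Automorphic.unitaryCharactersLinearIndependent` (file `UnitaryCharactersLinearIndependentProofs`); changes no count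
by itself.  HC_CM is proved only modulo the printed citations until rung 0 closes.

* §1 `re_inner_eigenvectorBasis` — the Rayleigh quotient at an eigenvector is the eigenvalue; `eigenvalues_mem_Icc` — `0 ≤ ⟪Tx,x⟫ ≤ R‖x‖²`
  puts every eigenvalue in `[0, R]`; `aeval_map_apply_eigenvectorBasis` — `P(T) bᵢ = P(λᵢ) bᵢ` for a REAL polynomial `P`;
  **`trace_aeval_map_eq_sum`** — `tr P(T) = Σᵢ P(λᵢ)`; **`trace_aeval_map_re_nonneg_le`** — `0 ≤ re tr P(T) ≤ C · finrank`, `im tr P(T) = 0`.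
* §2 **`exists_polynomial_eval_zero_eval_one_bounded`** — for `1 ≤ R`: `∃ P : ℝ[X]`, `P(0) = 0`, `P(1) = 1`, `∀ t ∈ [0,R], 0 ≤ P t ≤ 2`.

## References
* [JacquetLanglands1970] H. Jacquet, R. P. Langlands, *Automorphic Forms on GL(2)*, Lecture Notes in Math. 114, Springer (1970), Lemma 16.1.1.
* [Rogawski1990] J. D. Rogawski, *Automorphic Representations of Unitary Groups in Three Variables*, Ann. of Math. Stud. 123 (1990),
  Prop. 13.8.1 p. 206.
* [ReedSimonI1980] M. Reed, B. Simon, *Methods of Modern Mathematical Physics I: Functional Analysis*, Academic Press (1980), Thm. VII.1.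
-/

set_option autoImplicit false

open Polynomial Module
open scoped InnerProductSpace

namespace Literature.Analysis.InnerProduct

/-! ## §1 The trace of a real polynomial in a symmetric operator with Rayleigh quotients in `[0, R]` -/

section Trace

variable {E : Type*} [NormedAddCommGroup E] [InnerProductSpace ℂ E] [FiniteDimensional ℂ E]
  {T : E →ₗ[ℂ] E} {n : ℕ}

/-- The Rayleigh quotient of a symmetric operator at a vector of its orthonormal eigenbasis is the eigenvalue:
`re ⟪T bᵢ, bᵢ⟫ = λᵢ`. [cite: ReedSimonI1980, Thm. VII.1] -/
theorem re_inner_apply_eigenvectorBasis (hT : T.IsSymmetric) (hn : Module.finrank ℂ E = n) (i : Fin n) :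
    (⟪T (hT.eigenvectorBasis hn i), hT.eigenvectorBasis hn i⟫_ℂ).re = hT.eigenvalues hn i := by
  rw [hT.apply_eigenvectorBasis hn i, inner_smul_left, inner_self_eq_norm_sq_to_K,
    (hT.eigenvectorBasis hn).orthonormal.1 i]
  simp

/-- **Eigenvalues of an operator with `0 ≤ ⟪T x, x⟫ ≤ R‖x‖²` lie in `[0, R]`.** [cite: ReedSimonI1980, Thm. VII.1] -/
theorem eigenvalues_mem_Icc (hT : T.IsSymmetric) (hn : Module.finrank ℂ E = n) {R : ℝ}
    (h0 : ∀ x : E, 0 ≤ (⟪T x, x⟫_ℂ).re) (hR : ∀ x : E, (⟪T x, x⟫_ℂ).re ≤ R * ‖x‖ ^ 2) (i : Fin n) :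
    hT.eigenvalues hn i ∈ Set.Icc 0 R := by
  have h := re_inner_apply_eigenvectorBasis hT hn i
  refine ⟨?_, ?_⟩
  · rw [← h]; exact h0 _
  · have h2 := hR (hT.eigenvectorBasis hn i)
    rw [h, (hT.eigenvectorBasis hn).orthonormal.1 i, one_pow, mul_one] at h2
    exact h2

/-- `P(T) bᵢ = P(λᵢ) • bᵢ` for a real polynomial `P`, read through `ℂ` (★ `Module.End.aeval_apply_of_hasEigenvector`).
[cite: ReedSimonI1980, Thm. VII.1 (e)] -/
theorem aeval_map_apply_eigenvectorBasis (hT : T.IsSymmetric) (hn : Module.finrank ℂ E = n) (P : ℝ[X]) (i : Fin n) :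
    aeval T (P.map (algebraMap ℝ ℂ)) (hT.eigenvectorBasis hn i) =
      ((P.eval (hT.eigenvalues hn i) : ℝ) : ℂ) • hT.eigenvectorBasis hn i := by
  rw [Module.End.aeval_apply_of_hasEigenvector (hT.hasEigenvector_eigenvectorBasis hn i), eval_map,
    ← Complex.coe_algebraMap, eval₂_hom]

/-- **`tr P(T) = Σᵢ P(λᵢ)`** for a symmetric `T` with eigenvalues `λᵢ` (counted by an orthonormal eigenbasis) and a real polynomial `P`
(★ `LinearMap.trace_eq_sum_inner` in the eigenbasis). [cite: ReedSimonI1980, Thm. VII.1 (e)] -/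
theorem trace_aeval_map_eq_sum (hT : T.IsSymmetric) (hn : Module.finrank ℂ E = n) (P : ℝ[X]) :
    LinearMap.trace ℂ E (aeval T (P.map (algebraMap ℝ ℂ))) = ∑ i : Fin n, ((P.eval (hT.eigenvalues hn i) : ℝ) : ℂ) := by
  rw [LinearMap.trace_eq_sum_inner _ (hT.eigenvectorBasis hn)]
  refine Finset.sum_congr rfl fun i _ => ?_
  rw [aeval_map_apply_eigenvectorBasis hT hn P i, inner_smul_right, inner_self_eq_norm_sq_to_K,
    (hT.eigenvectorBasis hn).orthonormal.1 i]
  simp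

/-- **THE TRACE OF A BOUNDED POLYNOMIAL IN A POSITIVE OPERATOR** ([JacquetLanglands1970, Lemma 16.1.1], analytic step; functional
calculus [ReedSimonI1980, Thm. VII.1 (e)]).  Let `T` be a symmetric operator on a finite-dimensional complex inner product space with
`0 ≤ re ⟪T x, x⟫ ≤ R · ‖x‖²` for all `x`, and `P` a real polynomial with `0 ≤ P(t) ≤ C` for `t ∈ [0, R]`.  Then `tr P(T)` is a real
number in `[0, C · dim E]`: `0 ≤ re tr P(T)`, `re tr P(T) ≤ C · finrank ℂ E`, `im tr P(T) = 0`. [cite: JacquetLanglands1970, Lemma 16.1.1]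
[cite: ReedSimonI1980, Thm. VII.1 (e)] -/
theorem trace_aeval_map_re_nonneg_le (hT : T.IsSymmetric) {R C : ℝ}
    (h0 : ∀ x : E, 0 ≤ (⟪T x, x⟫_ℂ).re) (hR : ∀ x : E, (⟪T x, x⟫_ℂ).re ≤ R * ‖x‖ ^ 2)
    (P : ℝ[X]) (hP : ∀ t ∈ Set.Icc (0 : ℝ) R, 0 ≤ P.eval t ∧ P.eval t ≤ C) :
    0 ≤ (LinearMap.trace ℂ E (aeval T (P.map (algebraMap ℝ ℂ)))).re ∧
      (LinearMap.trace ℂ E (aeval T (P.map (algebraMap ℝ ℂ)))).re ≤ C * Module.finrank ℂ E ∧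
      (LinearMap.trace ℂ E (aeval T (P.map (algebraMap ℝ ℂ)))).im = 0 := by
  have hn : Module.finrank ℂ E = Module.finrank ℂ E := rfl
  have hmem : ∀ i, hT.eigenvalues hn i ∈ Set.Icc 0 R := eigenvalues_mem_Icc hT hn h0 hR
  rw [trace_aeval_map_eq_sum hT hn P, Complex.re_sum, Complex.im_sum]
  simp only [Complex.ofReal_re, Complex.ofReal_im, Finset.sum_const_zero]
  refine ⟨Finset.sum_nonneg fun i _ => (hP _ (hmem i)).1, ?_, trivial⟩
  calc ∑ i : Fin (Module.finrank ℂ E), P.eval (hT.eigenvalues hn i)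
      ≤ ∑ _i : Fin (Module.finrank ℂ E), C := Finset.sum_le_sum fun i _ => (hP _ (hmem i)).2
    _ = C * Module.finrank ℂ E := by rw [Finset.sum_const, Finset.card_univ, Fintype.card_fin, nsmul_eq_mul, mul_comm]

end Trace

/-! ## §2 A polynomial with `P(0) = 0`, `P(1) = 1`, `0 ≤ P ≤ 2` on `[0, R]` -/

/-- **The separating polynomial** ([JacquetLanglands1970, Lemma 16.1.1], the device): for every `R ≥ 1` there is a real polynomial `P`
with `P(0) = 0`, `P(1) = 1` and `0 ≤ P(t) ≤ 2` for all `t ∈ [0, R]` — take `P(t) = (1 − (1 − t/R)ⁿ)/(1 − (1 − 1/R)ⁿ)` with `n` so large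
that `(1 − 1/R)ⁿ ≤ 1/2` (★ `exists_pow_lt_of_lt_one`); on `[0, R]` one has `0 ≤ 1 − t/R ≤ 1`. [cite: JacquetLanglands1970, Lemma 16.1.1] -/
theorem exists_polynomial_eval_zero_eval_one_bounded {R : ℝ} (hR : 1 ≤ R) :
    ∃ P : ℝ[X], P.eval 0 = 0 ∧ P.eval 1 = 1 ∧ ∀ t ∈ Set.Icc (0 : ℝ) R, 0 ≤ P.eval t ∧ P.eval t ≤ 2 := by
  have hR0 : 0 < R := lt_of_lt_of_le one_pos hR
  set q : ℝ := 1 - 1 / R with hq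
  have hq0 : 0 ≤ q := by
    rw [hq, sub_nonneg, div_le_one hR0]; exact hR
  have hq1 : q < 1 := by
    rw [hq, sub_lt_self_iff]; positivity
  obtain ⟨n, hn⟩ := exists_pow_lt_of_lt_one (show (0 : ℝ) < 1 / 2 by norm_num) hq1
  set c : ℝ := 1 - q ^ n with hc
  have hc_pos : 1 / 2 < c := by rw [hc]; linarith
  have hc_le : c ≤ 1 := by
    rw [hc, sub_le_self_iff]; exact pow_nonneg hq0 n
  -- `P(t) = c⁻¹ · (1 − (1 − t/R)ⁿ)`
  refine ⟨Polynomial.C c⁻¹ * (1 - (1 - Polynomial.C (1 / R) * X) ^ n), ?_, ?_, ?_⟩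
  · simp
  · simp only [eval_mul, eval_C, eval_sub, eval_one, eval_pow, eval_X, mul_one]
    rw [← hq, ← hc, inv_mul_cancel₀ (by linarith)]
  · intro t ht
    simp only [eval_mul, eval_C, eval_sub, eval_one, eval_pow, eval_X]
    have hs0 : 0 ≤ 1 - 1 / R * t := by
      rw [sub_nonneg, one_div_mul_eq_div, div_le_one hR0]; exact ht.2
    have hs1 : 1 - 1 / R * t ≤ 1 := by
      rw [sub_le_self_iff]; exact mul_nonneg (by positivity) ht.1
    have hp0 : 0 ≤ (1 - 1 / R * t) ^ n := pow_nonneg hs0 n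
    have hp1 : (1 - 1 / R * t) ^ n ≤ 1 := pow_le_one₀ hs0 hs1
    have hcinv0 : 0 ≤ c⁻¹ := inv_nonneg.mpr (by linarith)
    have hcinv2 : c⁻¹ ≤ 2 := by
      rw [inv_le_comm₀ (by linarith) (by norm_num)]; linarith
    refine ⟨mul_nonneg hcinv0 (by linarith), ?_⟩
    calc c⁻¹ * (1 - (1 - 1 / R * t) ^ n) ≤ 2 * 1 :=
          mul_le_mul hcinv2 (by linarith) (by linarith) (by norm_num)
      _ = 2 := by norm_num

end Literature.Analysis.InnerProduct
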